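import Literature.NumberTheory.LFunctions.Zhang2022.RepairTentProfile

/-!
# `C₂₃₃(θ) = 𝔅(f_θ, f_θ)`: the (2.33)/(18.3) constant of every design is the main-term form of its tent

Trunk T-ANT (NumberTheory/LFunctions). Repair rung F-S1R (D-0077) for Y. Zhang, *Discrete mean estimates and
the Landau–Siegel zero*, arXiv:2211.02515v1 [Zhang2022LandauSiegel] — **an unrefereed manuscript under
adjudication; nothing here asserts any of its claims.** Structural route (lead ruling R3, `repair/p4/Q2-ARCHITECTURE.md`):
the dictionary identity for the `J`-block. Ingredients: `RepairTentProfile` (the tent `f_θ`, its tail functional =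
Lemma 10.2's `𝔶𝔶`-polynomials), `RepairFormulaIGram` (formula I as the sesquilinear form `Mform`, the Gram identity
`mainTermFormPolar_eq_Mform`: `P(g,h) = M(g,h) + conj M(h,g)` on one-sided kinked profiles), `RepairSection10Theta`
(the transcribed functionals `d7T θ j`, `S233T θ`, `C233T θ` of the proof of (2.33), §18 p.100).

* `intervalIntegrable_dipoleIntegrand` — the formula-I integrand of two kinked profiles is integrable on `[0,1]`
  (bookkeeping used by every dictionary evaluation).
* `integral_dipoleIntegrand_tentT` — **the `J·J̄` evaluation of §18**: `∫₀¹ (f′+iπjf)·conj(f′+iπS_jf+π²N_j∫_y^1f)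
  = σ²(∫_{ν₂}^{mid₁}(−1−jπi(z−ν₂))(−1+𝔶𝔶₁ⱼ) + ∫_{mid₁}^{ν₁}(1−jπi(ν₁−z))(1+𝔶𝔶₂ⱼ))` — i.e. `(1/π)·` it is EXACTLY
  the manuscript's `d₇ⱼ` (`d7T θ j`): the two displayed `n`-sums of the proof of (2.33) ARE formula I on the tent.
* `Mform_tentT : Mform f_θ f′_θ f_θ f′_θ = S233T θ` and **`mainTermForm_tentT_eq_C233T : 𝔅(f_θ,f_θ) = C₂₃₃(θ)`**
  (hypothesis `h233` of `RepairBarrierAssembly.not_repairable_true_need_of_dictionary`, as an equality).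
* the direct evaluation of (4.1) on the tent, `mainTermForm_tentT : 𝔅(f_θ,f_θ) = 16σ/π + 176π/(3σ)`, hence the
  closed form **`C233T_eq : C₂₃₃(θ) = 16σ/π + 176π/(3σ)`** (`σ = 2/(ν₁−ν₂)`; printed design `σ = 500`:
  `2546.479 + 0.369 = 2546.848`, the certified `Section10Certificate.C233_bounds`) — `Re d₇ⱼ = 2σ/π + 22π/(3σ)` for
  every `j` because `N_j + jS_j = 11` is the symmetric function `e₂(1,2,3)`.

Domain: `0 ≤ ν₂ < ν₁ ≤ 1`. No statement about Theorems 1–2 of the manuscript.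
-/

noncomputable section

open Complex Real ComplexConjugate MeasureTheory Set intervalIntegral

namespace Literature.NumberTheory.LFunctions.Zhang2022

namespace Repair

variable {θ : Theta} {g g' h h' : ℝ → ℂ}

/-! ### Integrability of the formula-I integrand -/

/-- the tail `y ↦ ∫_y^1 h` of a kinked profile is continuous on `[0,1]`.
[cite: Zhang2022LandauSiegel, Prop 7.1 with (8.11)–(8.23), pp.44–50] -/
theorem continuousOn_tail (hh : KinkedProfile h h') : ContinuousOn (fun y => ∫ t in y..1, h t) (Icc 0 1) := by
  have := intervalIntegral.continuousOn_primitive_interval_left (μ := volume) (f := h) (a := 0) (b := 1)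
    (by rw [uIcc_of_le zero_le_one]; exact hh.cont.integrableOn_Icc)
  rwa [uIcc_of_le zero_le_one] at this

/-- **the formula-I integrand of two kinked profiles is integrable on `[0,1]`** (`L²·L²`, `L²·C⁰`, `C⁰·C⁰` terms).
[cite: Zhang2022LandauSiegel, Prop 7.1 with (8.11)–(8.23), pp.44–50] -/
theorem intervalIntegrable_dipoleIntegrand (hg : KinkedProfile g g') (hh : KinkedProfile h h') (j : ℕ) :
    IntervalIntegrable (dipoleIntegrand j g g' h h') volume 0 1 := by
  have hgH := hg.isH1; have hhH := hh.isH1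
  have hT : ContinuousOn (fun y => conj (∫ t in y..1, h t)) (Icc 0 1) := continuousOn_conj_comp (continuousOn_tail hh)
  have i1 : IntervalIntegrable (fun x => g' x * conj (h' x)) volume 0 1 :=
    IsH1OnUnitInterval.intervalIntegrable_deriv_mul_conj_deriv hgH hhH
  have i2 : IntervalIntegrable (fun x => g' x * conj (h x)) volume 0 1 :=
    IsH1OnUnitInterval.intervalIntegrable_deriv_mul_conj hgH hhH
  have i3 : IntervalIntegrable (fun x => g' x * conj (∫ t in x..1, h t)) volume 0 1 :=
    hgH.intervalIntegrable.mul_continuousOn (by rw [uIcc_of_le zero_le_one]; exact hT)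
  have hch' : IntervalIntegrable (fun x => conj (h' x)) volume 0 1 := by
    rw [intervalIntegrable_iff, uIoc_of_le zero_le_one]; exact hhH.memLp_conj.integrable one_le_two
  have i4 : IntervalIntegrable (fun x => g x * conj (h' x)) volume 0 1 :=
    hch'.continuousOn_mul (by rw [uIcc_of_le zero_le_one]; exact hg.cont)
  have i5 : IntervalIntegrable (fun x => g x * conj (h x)) volume 0 1 :=
    IsH1OnUnitInterval.intervalIntegrable_mul_conj hgH hhH
  have i6 : IntervalIntegrable (fun x => g x * conj (∫ t in x..1, h t)) volume 0 1 :=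
    (hg.cont.mul hT).intervalIntegrable_of_Icc zero_le_one
  have e : dipoleIntegrand j g g' h h' = fun x =>
      g' x * conj (h' x) + (-(I * π * ((bS j : ℝ) : ℂ))) * (g' x * conj (h x))
        + ((π : ℂ) ^ 2 * ((bN j : ℝ) : ℂ)) * (g' x * conj (∫ t in x..1, h t))
        + (I * π * (j : ℂ)) * (g x * conj (h' x)) + ((π : ℂ) ^ 2 * (j : ℂ) * ((bS j : ℝ) : ℂ)) * (g x * conj (h x))
        + (I * (π : ℂ) ^ 3 * (j : ℂ) * ((bN j : ℝ) : ℂ)) * (g x * conj (∫ t in x..1, h t)) := by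
    funext x
    unfold dipoleIntegrand
    simp only [map_add, map_mul, map_pow, Complex.conj_I, Complex.conj_ofReal]
    linear_combination (-(π : ℂ) ^ 2 * (j : ℂ) * g x * ((bS j : ℝ) : ℂ) * conj (h x)) * Complex.I_sq
  rw [e]
  exact ((((i1.add (i2.const_mul _)).add (i3.const_mul _)).add (i4.const_mul _)).add (i5.const_mul _)).add
    (i6.const_mul _)

/-! ### The `J·J̄` evaluation: `∫₀¹ dipoleIntegrand j f f′ f f′ = πd₇ⱼ(θ)` -/

/-- **formula I on the tent against itself is the manuscript's `d₇ⱼ`**: splitting `[0,1]` at `ν₂, mid₁, ν₁`, the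
integrand vanishes off the tent and equals `σ²(−1−jπi(z−ν₂))(−1+𝔶𝔶₁ⱼ)` / `σ²(1−jπi(ν₁−z))(1+𝔶𝔶₂ⱼ)` on the two
halves (`tentDipole_*` × `tentTail_*`). [cite: Zhang2022LandauSiegel, §18 proof of (2.33) p.100] -/
theorem integral_dipoleIntegrand_tentT (h : θ.nu2 < θ.nu1) (h0 : 0 ≤ θ.nu2) (h1 : θ.nu1 ≤ 1) (j : ℕ) :
    ∫ y in (0:ℝ)..1, dipoleIntegrand j (tentT θ) (tentT' θ) (tentT θ) (tentT' θ) y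
      = (θ.sig : ℂ) ^ 2 *
        ((∫ z in θ.nu2..θ.mid1, (-1 - (j : ℂ) * π * I * (z - θ.nu2)) * (-1 + yy1T θ j z))
          + ∫ z in θ.mid1..θ.nu1, (1 - (j : ℂ) * π * I * ((θ.nu1 : ℂ) - z)) * (1 + yy2T θ j z)) := by
  have hm := θ.mid1_eq; have hn := θ.nu1_eq; have hp := θ.hw_pos h
  have hk := kinkedProfile_tentT h
  have hI := intervalIntegrable_dipoleIntegrand hk hk j
  have hsub : ∀ {a b : ℝ}, 0 ≤ a → a ≤ b → b ≤ 1 →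
      IntervalIntegrable (dipoleIntegrand j (tentT θ) (tentT' θ) (tentT θ) (tentT' θ)) volume a b :=
    fun ha hab hb => hI.mono_set (by rw [uIcc_of_le zero_le_one, uIcc_of_le hab]; exact Icc_subset_Icc ha hb)
  have hlo : (0:ℝ) ≤ θ.nu2 := h0
  have e0 : ∫ y in (0:ℝ)..θ.nu2, dipoleIntegrand j (tentT θ) (tentT' θ) (tentT θ) (tentT' θ) y = 0 := by
    rw [intervalIntegral.integral_congr_uIoo (g := fun _ => (0:ℂ)) fun y hy => ?_, intervalIntegral.integral_zero]
    rw [uIoo_of_le hlo] at hy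
    unfold dipoleIntegrand; rw [tentT'_of_lt_lo hy.2, tentT_of_le_lo h hy.2.le]; ring
  have e3 : ∫ y in θ.nu1..1, dipoleIntegrand j (tentT θ) (tentT' θ) (tentT θ) (tentT' θ) y = 0 := by
    rw [intervalIntegral.integral_congr_uIoo (g := fun _ => (0:ℂ)) fun y hy => ?_, intervalIntegral.integral_zero]
    rw [uIoo_of_le h1] at hy
    unfold dipoleIntegrand; rw [tentT'_of_hi_le h hy.1.le, tentT_of_hi_le h hy.1.le]; ring
  have e1 : ∫ y in θ.nu2..θ.mid1, dipoleIntegrand j (tentT θ) (tentT' θ) (tentT θ) (tentT' θ) y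
      = (θ.sig : ℂ) ^ 2 * ∫ z in θ.nu2..θ.mid1, (-1 - (j : ℂ) * π * I * (z - θ.nu2)) * (-1 + yy1T θ j z) := by
    rw [← intervalIntegral.integral_const_mul,
      intervalIntegral.integral_congr_uIoo fun y hy => ?_]
    rw [uIoo_of_le (by linarith)] at hy
    unfold dipoleIntegrand
    rw [tentDipole_lower hy.1.le hy.2, tentTail_lower h h1 hy.1.le hy.2]
    ring
  have e2 : ∫ y in θ.mid1..θ.nu1, dipoleIntegrand j (tentT θ) (tentT' θ) (tentT θ) (tentT' θ) y
      = (θ.sig : ℂ) ^ 2 * ∫ z in θ.mid1..θ.nu1, (1 - (j : ℂ) * π * I * ((θ.nu1 : ℂ) - z)) * (1 + yy2T θ j z) := by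
    rw [← intervalIntegral.integral_const_mul,
      intervalIntegral.integral_congr_uIoo fun y hy => ?_]
    rw [uIoo_of_le (by linarith)] at hy
    unfold dipoleIntegrand
    rw [tentDipole_upper h hy.1.le hy.2, tentTail_upper h h1 hy.1.le hy.2]
    ring
  have s1 := intervalIntegral.integral_add_adjacent_intervals
    (hsub (a := 0) (b := θ.nu2) le_rfl hlo (by linarith)) (hsub (a := θ.nu2) (b := 1) hlo (by linarith) le_rfl)
  have s2 := intervalIntegral.integral_add_adjacent_intervals
    (hsub (a := θ.nu2) (b := θ.mid1) hlo (by linarith) (by linarith))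
    (hsub (a := θ.mid1) (b := 1) (by linarith) (by linarith) le_rfl)
  have s3 := intervalIntegral.integral_add_adjacent_intervals
    (hsub (a := θ.mid1) (b := θ.nu1) (by linarith) (by linarith) h1)
    (hsub (a := θ.nu1) (b := 1) (by linarith) h1 le_rfl)
  rw [← s1, ← s2, ← s3, e0, e1, e2, e3]
  ring

/-- **`M(f_θ, f_θ) = S₂₃₃(θ) = ½d₇₁ + 2d₇₂ + 3/2·d₇₃`**: formula I on the tent IS the §18 evaluation of
`(½S₁ + 2S₂ + 3/2S₃)(𝐚₂₃,𝐚₂₃)/(α𝔞)`. [cite: Zhang2022LandauSiegel, §18 proof of (2.33) p.100] -/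
theorem Mform_tentT (h : θ.nu2 < θ.nu1) (h0 : 0 ≤ θ.nu2) (h1 : θ.nu1 ≤ 1) :
    Mform (tentT θ) (tentT' θ) (tentT θ) (tentT' θ) = S233T θ := by
  unfold Mform S233T d7T
  rw [integral_dipoleIntegrand_tentT h h0 h1, integral_dipoleIntegrand_tentT h h0 h1,
    integral_dipoleIntegrand_tentT h h0 h1]
  push_cast
  ring

/-- **`𝔅(f_θ, f_θ) = C₂₃₃(θ)`** — the (2.33) constant of every design is the main-term form of its tent (Gram
identity `P = M + M̄ᵀ` of `RepairFormulaIGram`; the tent is one-sided: `f_θ(1) = 0`). Hypothesis `h233` of the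
structural assembly, as an equality. [cite: Zhang2022LandauSiegel, (2.33) p.11, §18 (18.3) p.100] -/
theorem mainTermForm_tentT_eq_C233T (h : θ.nu2 < θ.nu1) (h0 : 0 ≤ θ.nu2) (h1 : θ.nu1 ≤ 1) :
    mainTermForm (tentT θ) (tentT' θ) = C233T θ := by
  have hk := kinkedProfile_tentT h
  have hf1 : tentT θ 1 = 0 := tentT_of_hi_le h h1
  have hP := mainTermFormPolar_eq_Mform hk hk hf1 hf1
  rw [mainTermFormPolar_self, Mform_tentT h h0 h1] at hP
  have := congrArg Complex.re hP
  simp only [Complex.ofReal_re, Complex.add_re, Complex.conj_re] at this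
  rw [this]; unfold C233T; ring

/-! ### The form value `𝔅(f_θ, f_θ) = 16σ/π + 176π/(3σ)` -/

/-- a real function constant on `(a,b)` integrates to `c(b−a)` (endpoint values irrelevant). [folklore] -/
private theorem integral_const_of_eqOn_Ioo {g : ℝ → ℝ} {a b c : ℝ} (hab : a ≤ b)
    (hg : ∀ x ∈ Ioo a b, g x = c) : ∫ x in a..b, g x = c * (b - a) := by
  rw [intervalIntegral.integral_of_le hab, ← MeasureTheory.setIntegral_congr_set Ioo_ae_eq_Ioc,
    MeasureTheory.setIntegral_congr_fun measurableSet_Ioo hg, MeasureTheory.setIntegral_const,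
    measureReal_def, Real.volume_Ioo, ENNReal.toReal_ofReal (by linarith), smul_eq_mul, mul_comm]

/-- `x ↦ ‖f′_θ(x)‖²` is interval-integrable (bounded and measurable). [cite: Zhang2022LandauSiegel, (2.28) p.10] -/
private theorem intervalIntegrable_normSq_tentT' (h : θ.nu2 < θ.nu1) (a b : ℝ) :
    IntervalIntegrable (fun x => ‖tentT' θ x‖ ^ 2) volume a b := by
  rw [intervalIntegrable_iff]
  refine Measure.integrableOn_of_bounded (M := θ.sig ^ 2) measure_Ioc_lt_top.ne
    (((measurable_tentT' θ).norm.pow_const 2).aestronglyMeasurable) (ae_of_all _ fun x => ?_)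
  rw [Real.norm_eq_abs, abs_of_nonneg (sq_nonneg _)]
  exact pow_le_pow_left₀ (norm_nonneg _) (norm_tentT'_le h x) 2

/-- `‖f′_θ‖² = 2σ` (two edges of length `h`, slope `±σ`, `σh = 1`). [cite: Zhang2022LandauSiegel, (2.28) p.10] -/
theorem integral_normSq_tentT' (h : θ.nu2 < θ.nu1) (h0 : 0 ≤ θ.nu2) (h1 : θ.nu1 ≤ 1) :
    ∫ x in (0:ℝ)..1, ‖tentT' θ x‖ ^ 2 = 2 * θ.sig := by
  have hm := θ.mid1_eq; have hn := θ.nu1_eq; have hp := θ.hw_pos h; have hs := θ.sig_mul_hw h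
  have I := fun a b => intervalIntegrable_normSq_tentT' h a b
  rw [← intervalIntegral.integral_add_adjacent_intervals (I 0 θ.nu2) (I θ.nu2 1),
    ← intervalIntegral.integral_add_adjacent_intervals (I θ.nu2 θ.mid1) (I θ.mid1 1),
    ← intervalIntegral.integral_add_adjacent_intervals (I θ.mid1 θ.nu1) (I θ.nu1 1),
    integral_const_of_eqOn_Ioo (c := 0) h0 fun x hx => by rw [tentT'_of_lt_lo hx.2]; simp,
    integral_const_of_eqOn_Ioo (c := θ.sig ^ 2) (by linarith) fun x hx => by
      rw [tentT'_lower hx.1.le hx.2, Complex.norm_real, Real.norm_eq_abs, sq_abs],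
    integral_const_of_eqOn_Ioo (c := θ.sig ^ 2) (by linarith) fun x hx => by
      rw [tentT'_upper h hx.1.le hx.2, norm_neg, Complex.norm_real, Real.norm_eq_abs, sq_abs],
    integral_const_of_eqOn_Ioo (c := 0) h1 fun x hx => by rw [tentT'_of_hi_le h hx.1.le]; simp,
    hn, hm]
  nlinarith [hs]

/-- `‖f_θ‖² = 2/(3σ)`. [cite: Zhang2022LandauSiegel, (2.28) p.10] -/
theorem integral_normSq_tentT (h : θ.nu2 < θ.nu1) (h0 : 0 ≤ θ.nu2) (h1 : θ.nu1 ≤ 1) :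
    ∫ x in (0:ℝ)..1, ‖tentT θ x‖ ^ 2 = 2 / (3 * θ.sig) := by
  have hm := θ.mid1_eq; have hn := θ.nu1_eq; have hp := θ.hw_pos h; have hs := θ.sig_mul_hw h
  have hσ := θ.sig_pos h
  have I : ∀ a b, IntervalIntegrable (fun x => ‖tentT θ x‖ ^ 2) volume a b := fun a b =>
    ((continuous_tentT θ).norm.pow 2).intervalIntegrable a b
  have e0 : ∫ x in (0:ℝ)..θ.nu2, ‖tentT θ x‖ ^ 2 = 0 := by
    rw [intervalIntegral.integral_congr (g := fun _ => (0:ℝ)) fun x hx => ?_, intervalIntegral.integral_zero]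
    rw [uIcc_of_le h0] at hx; simp [tentT_of_le_lo h hx.2]
  have e3 : ∫ x in θ.nu1..1, ‖tentT θ x‖ ^ 2 = 0 := by
    rw [intervalIntegral.integral_congr (g := fun _ => (0:ℝ)) fun x hx => ?_, intervalIntegral.integral_zero]
    rw [uIcc_of_le h1] at hx; simp [tentT_of_hi_le h hx.1]
  have e1 : ∫ x in θ.nu2..θ.mid1, ‖tentT θ x‖ ^ 2 = θ.sig ^ 2 * θ.hw ^ 3 / 3 := by
    have hF : ∀ x ∈ uIcc θ.nu2 θ.mid1,
        HasDerivAt (fun z => θ.sig ^ 2 * (z - θ.nu2) ^ 3 / 3) ((θ.sig * (x - θ.nu2)) ^ 2) x := by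
      intro x _
      have := ((((hasDerivAt_id x).sub_const θ.nu2).pow 3).const_mul (θ.sig ^ 2)).div_const 3
      exact this.congr_deriv (by norm_num [id]; try ring)
    rw [intervalIntegral.integral_congr (g := fun z => (θ.sig * (z - θ.nu2)) ^ 2) fun x hx => ?_,
      intervalIntegral.integral_eq_sub_of_hasDerivAt hF (Continuous.intervalIntegrable (by fun_prop) _ _), hm]
    · ring
    · rw [uIcc_of_le (by linarith)] at hx
      simp only [tentT_lower hx.1 hx.2, Complex.norm_real, Real.norm_eq_abs, sq_abs]
  have e2 : ∫ x in θ.mid1..θ.nu1, ‖tentT θ x‖ ^ 2 = θ.sig ^ 2 * θ.hw ^ 3 / 3 := by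
    have hF : ∀ x ∈ uIcc θ.mid1 θ.nu1,
        HasDerivAt (fun z => -(θ.sig ^ 2 * (θ.nu1 - z) ^ 3 / 3)) ((θ.sig * (θ.nu1 - x)) ^ 2) x := by
      intro x _
      have := (((((hasDerivAt_id x).const_sub θ.nu1).pow 3).const_mul (θ.sig ^ 2)).div_const 3).neg
      exact this.congr_deriv (by norm_num [id]; try ring)
    rw [intervalIntegral.integral_congr (g := fun z => (θ.sig * (θ.nu1 - z)) ^ 2) fun x hx => ?_,
      intervalIntegral.integral_eq_sub_of_hasDerivAt hF (Continuous.intervalIntegrable (by fun_prop) _ _), hn]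
    · ring
    · rw [uIcc_of_le (by linarith)] at hx
      simp only [tentT_upper hx.1 hx.2, Complex.norm_real, Real.norm_eq_abs, sq_abs]
  rw [← intervalIntegral.integral_add_adjacent_intervals (I 0 θ.nu2) (I θ.nu2 1),
    ← intervalIntegral.integral_add_adjacent_intervals (I θ.nu2 θ.mid1) (I θ.mid1 1),
    ← intervalIntegral.integral_add_adjacent_intervals (I θ.mid1 θ.nu1) (I θ.nu1 1), e0, e1, e2, e3,
    θ.hw_eq_inv_sig h]
  field_simp
  ring

/-- `⟨f′_θ, f_θ⟩` is real. [cite: Zhang2022LandauSiegel, (2.28) p.10] -/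
theorem integral_tentT'_mul_conj_tentT_im (θ : Theta) :
    (∫ x in (0:ℝ)..1, tentT' θ x * conj (tentT θ x)).im = 0 := by
  rw [intervalIntegral.integral_congr (g := fun x => ((tentR' θ x * tentR θ x : ℝ) : ℂ)) fun x _ => by
      simp [tentT, tentT', Complex.conj_ofReal], intervalIntegral.integral_ofReal, Complex.ofReal_im]

/-- `⟨f_θ, S_{f_θ}⟩` is real. [cite: Zhang2022LandauSiegel, (2.28) p.10] -/
theorem integral_tentT_mul_conj_primitive_im (θ : Theta) :
    (∫ x in (0:ℝ)..1, tentT θ x * conj (∫ t in (0:ℝ)..x, tentT θ t)).im = 0 := by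
  rw [intervalIntegral.integral_congr (g := fun x => ((tentR θ x * ∫ t in (0:ℝ)..x, tentR θ t : ℝ) : ℂ))
      fun x _ => by
        simp only [tentT, intervalIntegral.integral_ofReal, Complex.conj_ofReal]; push_cast; ring,
    intervalIntegral.integral_ofReal, Complex.ofReal_im]

/-- **the main-term form of the tent**: `𝔅(f_θ, f_θ) = 16σ/π + 176π/(3σ)` — the value the structural
dictionary assigns to `C₂₃₃(θ) = Ξ_J/(𝔞𝔓)` of (2.33) (printed design: `σ = 500`, `2546.479 + 0.369 =
2546.848`, the certified `C₂₃₃`). [cite: Zhang2022LandauSiegel, (2.33) p.11, §18 (18.3) p.100] -/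
theorem mainTermForm_tentT (h : θ.nu2 < θ.nu1) (h0 : 0 ≤ θ.nu2) (h1 : θ.nu1 ≤ 1) :
    mainTermForm (tentT θ) (tentT' θ) = 16 * θ.sig / π + 176 * π / (3 * θ.sig) := by
  have hσ := θ.sig_pos h
  rw [mainTermForm_eq, integral_normSq_tentT' h h0 h1, integral_normSq_tentT h h0 h1,
    integral_tentT'_mul_conj_tentT_im, integral_tentT_mul_conj_primitive_im,
    tentT_of_le_lo h h0, tentT_of_hi_le h h1]
  simp only [mul_zero, add_zero, map_zero, Complex.zero_re, Complex.zero_im, sub_zero]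
  field_simp
  ring

/-- **`C₂₃₃(θ) = 16σ/π + 176π/(3σ)`** (`σ = 2/(ν₁−ν₂)`): the transcribed (18.3) functional in closed form, by
comparing the two evaluations of `𝔅(f_θ,f_θ)`; `Re d₇ⱼ = 2σ/π + 22π/(3σ)` for every `j`
(`N_j + jS_j = 11`). Printed design: `σ = 500` gives `2546.8477…` (`Section10Certificate.C233_bounds`).
[cite: Zhang2022LandauSiegel, (2.33) p.11, §18 (18.3) p.100] -/
theorem C233T_eq (h : θ.nu2 < θ.nu1) (h0 : 0 ≤ θ.nu2) (h1 : θ.nu1 ≤ 1) :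
    C233T θ = 16 * θ.sig / π + 176 * π / (3 * θ.sig) := by
  rw [← mainTermForm_tentT_eq_C233T h h0 h1, mainTermForm_tentT h h0 h1]

/-- sanity: the closed form at the printed design, `C₂₃₃ = 8000/π + 44π/375`.
[cite: Zhang2022LandauSiegel, (2.33) p.11, §18 (18.3) p.100] -/
theorem C233_eq_closed : C233 = 8000 / π + 44 * π / 375 := by
  rw [← C233T_theta0, C233T_eq (by norm_num [theta0]) (by norm_num [theta0]) (by norm_num [theta0]), theta0_sig]
  ring

end Repair

end Literature.NumberTheory.LFunctions.Zhang2022
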